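import Literature.Analysis.FunctionSpaces.PoissonPointProcess
import Mathlib.MeasureTheory.Constructions.Pi
import HarnessLib

/-!
# Poisson point processes: void probabilities and the (multivariate) Mecke equation
(trunk T-KINETIC; topic Analysis/FunctionSpaces, next to `PoissonPointProcess`; serves the
Boltzmann–Grad limit of the Lorentz gas, named fact `Literature.MathematicalPhysics.KineticTheory.gallavotti_spohn_lorentz` of
`Literature.MathematicalPhysics.KineticTheory.ShortRangePotentials`)

Two pieces of Poisson-process calculus used in Gallavotti's derivation of the linear Boltzmann
equation from the Lorentz gas with Poisson scatterers (Gallavotti 1969/1972; F. Golse, *Recent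
results on the periodic Lorentz gas*, §2, proof of Thm. 2.1; H. Spohn, *Large Scale Dynamics of
Interacting Particles* (1991), proof of Thm. 8.8): the probability that a region is void of
scatterers, and the Mecke (Campbell–Slivnyak) formula computing expectations of sums over
`m`-tuples of distinct scatterers.

* `IsPoissonPointProcess.measure_count_eq_zero` (**proved**): the *void probability*
  `P(N(s) = 0) = e^{-ν(s)}` for measurable `s` of finite intensity (Last–Penrose 2017, Def. 3.1
  (i) with `k = 0`, printed as (6.6) in Thm 6.10 (Rényi); Kingman 1993 §2.1) — immediate from the
  Poisson marginal, Mathlib's `poissonMeasure_singleton`.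
* `PointConfig.ofFn x`: the finite configuration `{x₁, …, x_m}`, so that `c ∪ PointConfig.ofFn x`
  renders the counting measure `η + δ_{x₁} + ⋯ + δ_{x_m}` of Last–Penrose for simple
  configurations.
* `IsPoissonPointProcess.multivariateMecke` (named fact): the **multivariate Mecke equation**
  (Last–Penrose, *Lectures on the Poisson Process* (2017), Thm 4.4):
  `𝔼 ∑_{(x₁,…,x_m) ∈ c^m, distinct} h(x, c) = ∫ 𝔼 h(x, c ∪ {x₁,…,x_m}) ν^{⊗m}(dx)` for
  measurable `h ≥ 0`.

## Design

The tree's `Literature.PointConfig E` are *simple* locally finite configurations (sets), and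
`Literature.IsPoissonPointProcess ν P` (Kingman's definition: Poisson counts on sets of finite
intensity, independence over disjoint sets) is a predicate on a law `P` on the count σ-algebra.
Last–Penrose state Thm 4.4 for proper point processes as random counting measures with an
s-finite intensity on a general measurable space; the factorial measure `η^{(m)}` of a simple
configuration is the sum of Dirac masses at `m`-tuples of pairwise distinct points ((4.9)), which
is the `tsum` over the subtype of injective `x : Fin m → E` with values in `c` used below
(`ℝ≥0∞`-valued, so no summability issue), and `η + δ_{x₁} + ⋯ + δ_{x_m}` is rendered by the union
`c ∪ PointConfig.ofFn x`. The two agree almost everywhere: the intensity of a simple Poisson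
process has no atoms of finite mass (`IsPoissonPointProcess.measure_singleton`), so for
`ν^{⊗m}`-a.e. `x` the `xᵢ` are pairwise distinct and, for `P`-a.e. `c`, not in `c`. The fact is
vendored on second countable Hausdorff Borel spaces with a σ-finite intensity (where the law of
the process on the count σ-algebra is determined, `IsPoissonPointProcess.unique`, and unions are
measurable, `PointConfig.measurable_union`), which covers the Lorentz gas
(`E = ℝ^d`, `ν = λ • Leb`).

## References

* G. Last, M. Penrose, *Lectures on the Poisson Process*, Cambridge Univ. Press (2017), Thm 4.1
  (Mecke equation), Thm 4.4 (multivariate Mecke equation), Prop. 3.5 (mixed binomial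
  representation).
* J. F. C. Kingman, *Poisson Processes*, Oxford (1993), §2.1.
-/

open MeasureTheory ProbabilityTheory
open scoped ENNReal NNReal

namespace Literature.Analysis.FunctionSpaces

variable {E : Type*} [TopologicalSpace E]

namespace PointConfig

/-- The finite configuration `{x i | i ∈ ι}` of the values of a finitely indexed family of
points (Last–Penrose 2017, (4.10): the Dirac masses `δ_{x₁} + ⋯ + δ_{x_m}` added to the process,
for simple configurations). [cite: LastPenrose2017, Thm 4.4] -/
protected def ofFn {ι : Type*} [Finite ι] (x : ι → E) : PointConfig E where
  carrier := Set.range x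
  finite_inter_isCompact _ _ := (Set.finite_range x).subset Set.inter_subset_left

/-- Carrier of `PointConfig.ofFn`. [folklore] -/
@[simp] lemma carrier_ofFn {ι : Type*} [Finite ι] (x : ι → E) :
    (PointConfig.ofFn x).carrier = Set.range x := rfl

/-- Membership in `PointConfig.ofFn x`: exactly the values `x i`. [folklore] -/
@[simp] lemma mem_ofFn {ι : Type*} [Finite ι] {x : ι → E} {y : E} :
    y ∈ PointConfig.ofFn x ↔ ∃ i, x i = y := Iff.rfl

/-- Each `x i` belongs to `PointConfig.ofFn x`. [folklore] -/
lemma apply_mem_ofFn {ι : Type*} [Finite ι] (x : ι → E) (i : ι) : x i ∈ PointConfig.ofFn x :=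
  ⟨i, rfl⟩

/-- Membership in a superposition `c ∪ d`. [folklore] -/
@[simp] lemma mem_union {c d : PointConfig E} {y : E} : y ∈ c ∪ d ↔ y ∈ c ∨ y ∈ d := Iff.rfl

end PointConfig

namespace IsPoissonPointProcess

variable [MeasurableSpace E] {ν : Measure E} {P : Measure (PointConfig E)}

/-- **Void probability** of a Poisson point process: for measurable `s` of finite intensity,
`P(N(s) = 0) = e^{-ν(s)}` (Last–Penrose 2017, Def. 3.1 (i) at `k = 0`: `P(η(B) = 0) = Po(λ(B); 0)`;
printed as (6.6) in Thm 6.10 (Rényi's theorem); Kingman 1993 §2.1). Immediate from the Poisson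
marginal `N(s) ~ Po(ν(s))`. [cite: LastPenrose2017, Def 3.1 (cf. (6.6) in Thm 6.10)] -/
theorem measure_count_eq_zero (h : IsPoissonPointProcess ν P) {s : Set E} (hs : MeasurableSet s)
    (hν : ν s ≠ ∞) :
    P {c | c.count s = 0} = ENNReal.ofReal (Real.exp (-(ν s).toReal)) := by
  have hm := PointConfig.measurable_count (E := E) hs
  have h1 : {c : PointConfig E | c.count s = 0} = (fun c => c.count s) ⁻¹' {0} := rfl
  rw [h1, ← Measure.map_apply hm (measurableSet_singleton _), h.map_count hs hν,
    Measure.map_apply measurable_from_top (measurableSet_singleton _)]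
  have h2 : ((↑) : ℕ → ℕ∞) ⁻¹' {0} = {0} := by
    ext n; simp
  rw [h2, poissonMeasure_singleton]
  simp [ENNReal.coe_toNNReal_eq_toReal]

/-- **Void probability**, real-valued form: `P.real {N(s) = 0} = exp (-ν(s))`.
[cite: LastPenrose2017, Def 3.1 (cf. (6.6) in Thm 6.10)] -/
theorem measureReal_count_eq_zero (h : IsPoissonPointProcess ν P) {s : Set E}
    (hs : MeasurableSet s) (hν : ν s ≠ ∞) :
    P.real {c | c.count s = 0} = Real.exp (-(ν s).toReal) := by
  rw [measureReal_def, h.measure_count_eq_zero hs hν, ENNReal.toReal_ofReal (Real.exp_nonneg _)]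

/-- The void probability tends to `1` as the intensity of the region tends to `0`: quantitatively
`1 - P(N(s) = 0) ≤ ν(s)` (from `1 - e^{-a} ≤ a`). [folklore] -/
theorem one_sub_measureReal_count_eq_zero_le (h : IsPoissonPointProcess ν P) {s : Set E}
    (hs : MeasurableSet s) (hν : ν s ≠ ∞) :
    1 - P.real {c | c.count s = 0} ≤ (ν s).toReal := by
  rw [h.measureReal_count_eq_zero hs hν]
  have := Real.add_one_le_exp (-(ν s).toReal)
  linarith

/-- **The multivariate Mecke equation** (Last–Penrose, *Lectures on the Poisson Process* (2017),
Thm 4.4; `m = 1` is the Mecke equation, Thm 4.1, which characterises the Poisson process). Let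
`P` be a Poisson point process on a second countable Hausdorff Borel space `E` with σ-finite
intensity `ν`. Then for every `m` and every measurable `h : (Fin m → E) × PointConfig E → [0, ∞]`,
`𝔼_P [ ∑_{x ∈ c^m, xᵢ pairwise distinct} h(x, c) ] = ∫_{E^m} 𝔼_P [ h(x, c ∪ {x₁, …, x_m}) ] ν^{⊗m}(dx)`.
Here the factorial measure `c^{(m)}` of the simple configuration `c` is the counting measure of
`m`-tuples of pairwise distinct points of `c` (Last–Penrose (4.9)), written as a `tsum` in
`ℝ≥0∞` over the subtype of injective `x : Fin m → E` with values in `c`, and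
`η + δ_{x₁} + ⋯ + δ_{x_m}` is the union `c ∪ PointConfig.ofFn x` (faithful a.e.: the intensity of
a simple Poisson process is atomless, `IsPoissonPointProcess.measure_singleton`, so `ν^{⊗m}`-a.e.
the `xᵢ` are distinct and `P`-a.s. not points of `c`). In Gallavotti's proof of the Lorentz-gas
limit this computes the expectation of the sum over ordered `n`-tuples of distinct scatterers hit
by the light particle. [cite: LastPenrose2017, Thm 4.4] -/
def multivariateMecke : Prop :=
  ∀ {E : Type*} [TopologicalSpace E] [T2Space E] [SecondCountableTopology E] [MeasurableSpace E]
    [BorelSpace E] {ν : Measure E} [SigmaFinite ν] {P : Measure (PointConfig E)}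
    (_h : IsPoissonPointProcess ν P) (m : ℕ) (h : (Fin m → E) × PointConfig E → ℝ≥0∞)
    (_hh : Measurable h),
    ∫⁻ c, (∑' x : {x : Fin m → E // Function.Injective x ∧ ∀ i, x i ∈ c}, h (x.1, c)) ∂P =
      ∫⁻ x, ∫⁻ c, h (x, c ∪ PointConfig.ofFn x) ∂P ∂(Measure.pi fun _ : Fin m => ν)

end IsPoissonPointProcess

end Literature.Analysis.FunctionSpaces
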